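import Mathlib.Order.PiLex
import Mathlib.Data.Finset.Sort
import Mathlib.Data.Nat.Log
import Literature.Algebra.EuclideanLattices.RegevBallGeometry
import HarnessLib

/-!
# Regev 2004, §3.3: the point set of a register — a quantised ball of exactly `2^κ` grid points

Topic `Algebra/EuclideanLattices` (family `pqc`); proved material towards the discharge of the
named fact `Literature.Algebra.EuclideanLattices.usvp_of_dihedralCoset` (O. Regev, *Quantum
computation and lattice problems*, SIAM J. Comput. 33 (2004) 738–760, Thm. 1.1). No named fact is
introduced; everything is proved.

In the proof of Lemma 3.12 each register is blurred by a uniform grid point `x̄` of a ball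
`Bₙ = B(0, R)` (the state `|η⟩` of Lemma 3.11), and Claim 3.14 bounds the probability that the
partner point `x̄ ∓ ū` leaves the ball by Cor. 3.9 (`1 − O(√n ‖ū‖/R)`). Lemma 3.11 prepares `|η⟩`
only approximately (Grover–Rudolph with approximate volume computations). For an *exact*
preparation over the Clifford+T gate set one needs a point set whose size is a power of two and
which can be ranked/unranked in polynomial time; this file supplies such a set with the same
geometry, and proves the estimate of Cor. 3.9 / Claim 3.14 for it:

* `qWeight Δ v = ⌈v²/Δ⌉` and the **quantised ball** `qBall n Q Δ = {x ∈ ℤⁿ | ∑ᵢ ⌈xᵢ²/Δ⌉ ≤ Q}`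
  (a separable body with `Q` levels, countable coordinate by coordinate), sandwiched between
  Euclidean balls: `ℤⁿ ∩ B̄(0, √((Q−n)Δ)) ⊆ qBall ⊆ B̄(0, √(QΔ))`
  (`mem_qBall_of_norm_sq_le`, `norm_sq_le_of_mem_qBall`);
* the **lexicographic prefix** `lexPrefix S k` of a finite `S ⊆ ℤⁿ` (first coordinate most
  significant; `Finset.orderEmbOfFin` on `Lex (Fin n → ℤ)`), its cardinality `k`, and the
  **threshold property** (`lexPrefix_threshold`): for some `c`, `S ∩ {x₀ < c} ⊆ lexPrefix S k ⊆
  S ∩ {x₀ ≤ c}` — a lexicographic prefix is a half-space cut up to one hyperplane section;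
* `pointSet n Q Δ = lexPrefix (qBall n Q Δ) 2^κ`, `κ = ⌊log₂ |qBall|⌋`: **exactly `2^κ ≥ |qBall|/2`
  points** (`card_pointSet`, `card_qBall_le_two_mul`);
* **the shift estimate** (Cor. 3.9 / Claim 3.14 for `pointSet`): for `s ∈ ℤⁿ` the points `x` of
  the set with `x − s` outside it lie in `U₁ ∪ U₂`, `U₁ = ℤⁿ ∩ (B̄(0,R₊) ∖ B̄(s, R₋))`,
  `U₂` a slab of width `|s₀|` (`filter_sub_notMem_subset`), whence by `RegevBallGeometry.lean`
  (**`card_filter_sub_notMem_le_volume`**, **`volume_le_two_mul_card_pointSet`**):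
  `#{x ∈ X | x − s ∉ X} ≤ [V(R′) − V(r′)] + ‖s‖ V_{n−1}(r′) + (‖s‖ + 2√n) V_{n−1}(R′)` and
  `V(r′) ≤ 2 |X|`, with `R′ = √(QΔ) + √n`, `r′ = √((Q−n)Δ) − √n` and `V`, `V_{n−1}` the volumes
  of Euclidean balls in dimensions `n`, `n − 1`.

## References

* O. Regev, *Quantum computation and lattice problems*, SIAM J. Comput. 33 (2004) 738–760,
  §3.3: Claims 3.7–3.8, Cor. 3.9 (p. 10), Lemma 3.11 (pp. 11–13), Claim 3.14 (p. 15).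
* L. Grover, T. Rudolph, *Creating superpositions that correspond to efficiently integrable
  probability distributions*, arXiv:quant-ph/0208112 (2002) (cited by Regev for Lemma 3.11).
-/

noncomputable section

namespace Literature.Algebra.EuclideanLattices

namespace Regev2004

open _root_.MeasureTheory Metric Finset

variable {n : ℕ}

/-! ### The quantised ball -/

/-- The quantised square `⌈v²/Δ⌉` (as a natural number; `Δ ≥ 1`). [cite: Regev2004, Lemma 3.11 (the grid points of a ball; quantised variant)] -/
def qWeight (Δ : ℕ) (v : ℤ) : ℕ := (v.natAbs ^ 2 + (Δ - 1)) / Δ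

/-- `Δ ⌈v²/Δ⌉ ≥ v²`. [folklore] -/
theorem sq_le_mul_qWeight {Δ : ℕ} (hΔ : 0 < Δ) (v : ℤ) : v.natAbs ^ 2 ≤ Δ * qWeight Δ v := by
  unfold qWeight
  have h := Nat.div_add_mod (v.natAbs ^ 2 + (Δ - 1)) Δ
  have hlt := Nat.mod_lt (v.natAbs ^ 2 + (Δ - 1)) hΔ
  omega

/-- `Δ ⌈v²/Δ⌉ ≤ v² + Δ − 1 < v² + Δ`. [folklore] -/
theorem mul_qWeight_le {Δ : ℕ} (v : ℤ) : Δ * qWeight Δ v ≤ v.natAbs ^ 2 + (Δ - 1) :=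
  Nat.mul_div_le _ _

/-- `qWeight` is even in `v`. [folklore] -/
theorem qWeight_neg (Δ : ℕ) (v : ℤ) : qWeight Δ (-v) = qWeight Δ v := by simp [qWeight]

/-- The coordinate bound `T = ⌊√(QΔ)⌋`: `⌈v²/Δ⌉ ≤ Q` forces `|v| ≤ T`. [folklore] -/
theorem natAbs_le_sqrt_of_qWeight_le {Δ Q : ℕ} (hΔ : 0 < Δ) {v : ℤ} (h : qWeight Δ v ≤ Q) :
    v.natAbs ≤ Nat.sqrt (Q * Δ) := by
  rw [Nat.le_sqrt']
  calc v.natAbs ^ 2 ≤ Δ * qWeight Δ v := sq_le_mul_qWeight hΔ v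
    _ ≤ Δ * Q := Nat.mul_le_mul_left _ h
    _ = Q * Δ := Nat.mul_comm _ _

/-- **The quantised ball** `{x ∈ ℤⁿ | ∑ᵢ ⌈xᵢ²/Δ⌉ ≤ Q}` (as a `Finset`, cut out of the cube
`[−T, T]ⁿ`, `T = ⌊√(QΔ)⌋`, which contains it). [cite: Regev2004, Lemma 3.11 and Claim 3.14 (the grid points of the ball, quantised variant)] -/
def qBall (n Q Δ : ℕ) : Finset (Fin n → ℤ) :=
  (Fintype.piFinset fun _ : Fin n => Finset.Icc (-(Nat.sqrt (Q * Δ) : ℤ)) (Nat.sqrt (Q * Δ))).filter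
    fun x => ∑ i, qWeight Δ (x i) ≤ Q

/-- **Membership in the quantised ball** is the level condition alone (`Δ ≥ 1`). [folklore] -/
theorem mem_qBall_iff {Q Δ : ℕ} (hΔ : 0 < Δ) (x : Fin n → ℤ) : x ∈ qBall n Q Δ ↔ ∑ i, qWeight Δ (x i) ≤ Q := by
  simp only [qBall, Finset.mem_filter, Fintype.mem_piFinset, Finset.mem_Icc, and_iff_right_iff_imp]
  intro h i
  have hi : qWeight Δ (x i) ≤ Q := (Finset.single_le_sum (fun j _ => Nat.zero_le _) (Finset.mem_univ i)).trans h
  have := natAbs_le_sqrt_of_qWeight_le hΔ hi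
  omega

/-- The quantised ball is symmetric under negating a coordinate… [folklore] -/
theorem neg_mem_qBall_iff {Q Δ : ℕ} (hΔ : 0 < Δ) (x : Fin n → ℤ) : -x ∈ qBall n Q Δ ↔ x ∈ qBall n Q Δ := by
  simp [mem_qBall_iff hΔ, qWeight_neg]

/-- **Outer ball**: `x ∈ qBall ⇒ ‖x‖² ≤ QΔ`. [cite: Regev2004, Lemma 3.11 (B_n is the ball of radius R)] -/
theorem norm_sq_le_of_mem_qBall {Q Δ : ℕ} (hΔ : 0 < Δ) {x : Fin n → ℤ} (hx : x ∈ qBall n Q Δ) :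
    ‖intVecToEuclidean n x‖ ^ 2 ≤ (Q : ℝ) * Δ := by
  rw [mem_qBall_iff hΔ] at hx
  rw [norm_sq_eq_sum]
  have hcoord : ∀ i, (intVecToEuclidean n x i) ^ 2 = (((x i).natAbs ^ 2 : ℕ) : ℝ) := fun i => by
    rw [intVecToEuclidean_apply, Nat.cast_pow, Nat.cast_natAbs, Int.cast_abs, sq_abs]
  calc ∑ i, (intVecToEuclidean n x i) ^ 2 = ∑ i, (((x i).natAbs ^ 2 : ℕ) : ℝ) := Finset.sum_congr rfl fun i _ => hcoord i
    _ ≤ ∑ i, ((Δ * qWeight Δ (x i) : ℕ) : ℝ) := Finset.sum_le_sum fun i _ => by exact_mod_cast sq_le_mul_qWeight hΔ (x i)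
    _ = (Δ : ℝ) * ((∑ i, qWeight Δ (x i) : ℕ) : ℝ) := by push_cast; rw [Finset.mul_sum]
    _ ≤ (Δ : ℝ) * Q := by gcongr
    _ = (Q : ℝ) * Δ := mul_comm _ _

/-- **Inner ball**: `‖x‖² ≤ (Q − n)Δ ⇒ x ∈ qBall` (for `x ∈ ℤⁿ`, `n ≤ Q`).
[cite: Regev2004, Cor. 3.9 (the bodies contain a large ball)] -/
theorem mem_qBall_of_norm_sq_le {Q Δ : ℕ} (hΔ : 0 < Δ) (hnQ : n ≤ Q) {x : Fin n → ℤ}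
    (hx : ‖intVecToEuclidean n x‖ ^ 2 ≤ ((Q : ℝ) - n) * Δ) : x ∈ qBall n Q Δ := by
  rw [mem_qBall_iff hΔ]
  -- `Δ ∑ ⌈xᵢ²/Δ⌉ ≤ ∑ xᵢ² + n (Δ − 1) ≤ (Q − n) Δ + n(Δ − 1) < (Q − n + n) Δ`
  have hcoord : ∀ i, (intVecToEuclidean n x i) ^ 2 = (((x i).natAbs ^ 2 : ℕ) : ℝ) := fun i => by
    rw [intVecToEuclidean_apply, Nat.cast_pow, Nat.cast_natAbs, Int.cast_abs, sq_abs]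
  have hsum : ((∑ i, (x i).natAbs ^ 2 : ℕ) : ℝ) ≤ ((Q : ℝ) - n) * Δ := by
    rw [norm_sq_eq_sum] at hx
    calc ((∑ i, (x i).natAbs ^ 2 : ℕ) : ℝ) = ∑ i, (intVecToEuclidean n x i) ^ 2 := by
          rw [Nat.cast_sum]; exact Finset.sum_congr rfl fun i _ => (hcoord i).symm
      _ ≤ ((Q : ℝ) - n) * Δ := hx
  have hnat : ∑ i, (x i).natAbs ^ 2 ≤ (Q - n) * Δ := by
    have : ((Q : ℝ) - n) = ((Q - n : ℕ) : ℝ) := by push_cast [Nat.cast_sub hnQ]; ring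
    rw [this] at hsum
    exact_mod_cast hsum
  have h1 : Δ * ∑ i, qWeight Δ (x i) ≤ ∑ i, ((x i).natAbs ^ 2 + (Δ - 1)) := by
    rw [Finset.mul_sum]
    exact Finset.sum_le_sum fun i _ => mul_qWeight_le (x i)
  rw [Finset.sum_add_distrib, Finset.sum_const, Finset.card_univ, Fintype.card_fin, smul_eq_mul] at h1
  have h2 : Δ * ∑ i, qWeight Δ (x i) < Δ * (Q + 1) := by
    calc Δ * ∑ i, qWeight Δ (x i) ≤ (Q - n) * Δ + n * (Δ - 1) := h1.trans (Nat.add_le_add_right hnat _)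
      _ < Δ * (Q + 1) := by
          have hc : n * (Δ - 1) ≤ n * Δ := Nat.mul_le_mul_left _ (Nat.sub_le _ _)
          have hab : (Q - n) * Δ + n * Δ = Q * Δ := by rw [← Nat.add_mul, Nat.sub_add_cancel hnQ]
          have e : Δ * (Q + 1) = Q * Δ + Δ := by ring
          omega
  have := Nat.lt_of_mul_lt_mul_left h2
  omega

/-! ### Lexicographic prefixes of a finite set of integer vectors -/

section LexPrefix

/-- A finite set of integer vectors, transported to the lexicographic order (first coordinate most
significant). [folklore] -/
def lexImage (S : Finset (Fin n → ℤ)) : Finset (Lex (Fin n → ℤ)) := S.map toLex.toEmbedding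

/-- `lexImage` preserves cardinality. [folklore] -/
@[simp] theorem card_lexImage (S : Finset (Fin n → ℤ)) : (lexImage S).card = S.card := Finset.card_map _

/-- Membership in `lexImage`. [folklore] -/
theorem mem_lexImage_iff (S : Finset (Fin n → ℤ)) (y : Lex (Fin n → ℤ)) : y ∈ lexImage S ↔ ofLex y ∈ S := by
  constructor
  · intro h
    obtain ⟨x, hx, rfl⟩ := Finset.mem_map.1 h
    exact hx
  · intro h
    exact Finset.mem_map.2 ⟨ofLex y, h, rfl⟩

/-- **The lexicographic prefix** of length `k ≤ |S|`: the `k` lexicographically smallest elements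
of `S`. [cite: Regev2004, Lemma 3.11 (a set of grid points whose uniform superposition is prepared; here made of size 2^κ)] -/
def lexPrefix (S : Finset (Fin n → ℤ)) (k : ℕ) (hk : k ≤ S.card) : Finset (Fin n → ℤ) :=
  (Finset.univ : Finset (Fin k)).map
    ((Fin.castLEEmb hk).trans
      (((lexImage S).orderEmbOfFin (card_lexImage S)).toEmbedding.trans ofLex.toEmbedding))

/-- The `i`-th smallest element of `S` (`i < |S|`), as an integer vector. [folklore] -/
def nthLex (S : Finset (Fin n → ℤ)) (i : Fin S.card) : Fin n → ℤ :=
  ofLex ((lexImage S).orderEmbOfFin (card_lexImage S) i)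

/-- `nthLex` takes values in `S`. [folklore] -/
theorem nthLex_mem (S : Finset (Fin n → ℤ)) (i : Fin S.card) : nthLex S i ∈ S :=
  (mem_lexImage_iff S _).1 (Finset.orderEmbOfFin_mem _ _ i)

/-- `nthLex` is strictly increasing for the lexicographic order. [folklore] -/
theorem toLex_nthLex_lt {S : Finset (Fin n → ℤ)} {i j : Fin S.card} (h : i < j) :
    toLex (nthLex S i) < toLex (nthLex S j) :=
  ((lexImage S).orderEmbOfFin (card_lexImage S)).strictMono h

/-- `nthLex` is injective. [folklore] -/
theorem nthLex_injective (S : Finset (Fin n → ℤ)) : Function.Injective (nthLex S) := fun i j h =>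
  ((lexImage S).orderEmbOfFin (card_lexImage S)).injective (by
    have := congrArg toLex h; simpa [nthLex] using this)

/-- Every element of `S` is some `nthLex S i`. [folklore] -/
theorem exists_nthLex_eq {S : Finset (Fin n → ℤ)} {x : Fin n → ℤ} (hx : x ∈ S) : ∃ i, nthLex S i = x := by
  have h : toLex x ∈ Set.range ((lexImage S).orderEmbOfFin (card_lexImage S)) := by
    rw [Finset.range_orderEmbOfFin]
    exact (mem_lexImage_iff S _).2 hx
  obtain ⟨i, hi⟩ := h
  exact ⟨i, by rw [nthLex, hi]; rfl⟩

/-- Membership in the lexicographic prefix: `x = nthLex S i` for some `i < k`. [folklore] -/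
theorem mem_lexPrefix_iff {S : Finset (Fin n → ℤ)} {k : ℕ} (hk : k ≤ S.card) (x : Fin n → ℤ) :
    x ∈ lexPrefix S k hk ↔ ∃ i : Fin S.card, (i : ℕ) < k ∧ nthLex S i = x := by
  simp only [lexPrefix, Finset.mem_map, Finset.mem_univ, true_and, Function.Embedding.trans_apply,
    Equiv.coe_toEmbedding]
  constructor
  · rintro ⟨i, rfl⟩
    exact ⟨Fin.castLEEmb hk i, i.isLt, rfl⟩
  · rintro ⟨i, hi, rfl⟩
    exact ⟨⟨i, hi⟩, rfl⟩

/-- The prefix lies in `S`. [folklore] -/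
theorem lexPrefix_subset {S : Finset (Fin n → ℤ)} {k : ℕ} (hk : k ≤ S.card) : lexPrefix S k hk ⊆ S := by
  intro x hx
  obtain ⟨i, -, rfl⟩ := (mem_lexPrefix_iff hk x).1 hx
  exact nthLex_mem S i

/-- **The prefix has exactly `k` elements.** [folklore] -/
theorem card_lexPrefix {S : Finset (Fin n → ℤ)} {k : ℕ} (hk : k ≤ S.card) : (lexPrefix S k hk).card = k := by
  rw [lexPrefix, Finset.card_map, Finset.card_univ, Fintype.card_fin]

/-- **Threshold property of a lexicographic prefix** (dimension `n ≥ 1`): there is an integer `c`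
with `S ∩ {x₀ < c} ⊆ lexPrefix S k ⊆ S ∩ {x₀ ≤ c}` — the first coordinate of the first element
left out, or one more than every first coordinate if nothing is left out. [folklore] -/
theorem lexPrefix_threshold {m : ℕ} (S : Finset (Fin (m + 1) → ℤ)) {k : ℕ} (hk : k ≤ S.card) :
    ∃ c : ℤ, (∀ x ∈ S, x 0 < c → x ∈ lexPrefix S k hk) ∧ (∀ x ∈ lexPrefix S k hk, x 0 ≤ c) := by
  by_cases hkS : k < S.card
  · -- the threshold is the first coordinate of the `k`-th element
    refine ⟨nthLex S ⟨k, hkS⟩ 0, fun x hx hlt => ?_, fun x hx => ?_⟩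
    · obtain ⟨i, rfl⟩ := exists_nthLex_eq hx
      refine (mem_lexPrefix_iff hk _).2 ⟨i, ?_, rfl⟩
      by_contra hik
      have hle : (⟨k, hkS⟩ : Fin S.card) ≤ i := not_lt.1 hik
      rcases hle.lt_or_eq with hlt' | heq
      · have := toLex_nthLex_lt hlt'
        have h0 := Pi.apply_le_of_toLex this.le (i := 0) (fun j hj => absurd hj (Fin.not_lt_zero j))
        exact absurd hlt (not_lt.2 h0)
      · rw [← heq] at hlt
        exact lt_irrefl _ hlt
    · obtain ⟨i, hi, rfl⟩ := (mem_lexPrefix_iff hk x).1 hx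
      have hlt : i < ⟨k, hkS⟩ := hi
      exact Pi.apply_le_of_toLex (toLex_nthLex_lt hlt).le (i := 0) (fun j hj => absurd hj (Fin.not_lt_zero j))
  · -- nothing is left out: `lexPrefix = S`
    have hkeq : k = S.card := le_antisymm hk (not_lt.1 hkS)
    obtain ⟨c, hc⟩ : ∃ c : ℤ, ∀ x ∈ S, x 0 ≤ c := by
      refine ⟨(S.sup fun x => (x 0).toNat : ℕ), fun x hx => ?_⟩
      have := Finset.le_sup (f := fun x : Fin (m + 1) → ℤ => (x 0).toNat) hx
      have h2 : x 0 ≤ (x 0).toNat := Int.self_le_toNat _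
      exact h2.trans (by exact_mod_cast this)
    refine ⟨c, fun x hx _ => ?_, fun x hx => hc x (lexPrefix_subset hk hx)⟩
    obtain ⟨i, rfl⟩ := exists_nthLex_eq hx
    exact (mem_lexPrefix_iff hk _).2 ⟨i, hkeq ▸ i.isLt, rfl⟩

end LexPrefix

/-! ### The point set of a register: `2^κ` points of the quantised ball -/

/-- The exponent `κ = ⌊log₂ |qBall|⌋`. [folklore] -/
def kappa (n Q Δ : ℕ) : ℕ := Nat.log 2 (qBall n Q Δ).card

/-- `2^κ ≤ |qBall|` (the quantised ball is nonempty: it contains `0`). [folklore] -/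
theorem two_pow_kappa_le (n Q Δ : ℕ) (hΔ : 0 < Δ) : 2 ^ kappa n Q Δ ≤ (qBall n Q Δ).card := by
  apply Nat.pow_log_le_self
  have h0 : (0 : Fin n → ℤ) ∈ qBall n Q Δ := by
    rw [mem_qBall_iff hΔ]
    have e : qWeight Δ 0 = 0 := by
      unfold qWeight
      rw [Int.natAbs_zero, zero_pow two_ne_zero, Nat.zero_add]
      exact Nat.div_eq_of_lt (Nat.sub_lt hΔ Nat.one_pos)
    simp [e]
  exact Finset.card_ne_zero_of_mem h0

/-- `|qBall| < 2^{κ+1}`, i.e. `|qBall| ≤ 2 · 2^κ`. [folklore] -/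
theorem card_qBall_le_two_mul (n Q Δ : ℕ) : (qBall n Q Δ).card ≤ 2 * 2 ^ kappa n Q Δ := by
  have := Nat.lt_pow_succ_log_self (b := 2) Nat.one_lt_two (qBall n Q Δ).card
  rw [pow_succ] at this
  unfold kappa
  omega

/-- **The point set of a register**: the lexicographic prefix of length `2^κ` of the quantised
ball. Its uniform superposition is prepared exactly from `κ` Hadamard coins by unranking.
[cite: Regev2004, Lemma 3.11 (the state |η⟩, exact power-of-two variant)] -/
def pointSet (n Q Δ : ℕ) (hΔ : 0 < Δ) : Finset (Fin n → ℤ) :=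
  lexPrefix (qBall n Q Δ) (2 ^ kappa n Q Δ) (two_pow_kappa_le n Q Δ hΔ)

/-- **Exactly `2^κ` points.** [folklore] -/
theorem card_pointSet (n Q Δ : ℕ) (hΔ : 0 < Δ) : (pointSet n Q Δ hΔ).card = 2 ^ kappa n Q Δ :=
  card_lexPrefix _

/-- The point set lies in the quantised ball. [folklore] -/
theorem pointSet_subset_qBall (n Q Δ : ℕ) (hΔ : 0 < Δ) : pointSet n Q Δ hΔ ⊆ qBall n Q Δ :=
  lexPrefix_subset _

/-- **At least half of the quantised ball.** [folklore] -/
theorem card_qBall_le_two_mul_card_pointSet (n Q Δ : ℕ) (hΔ : 0 < Δ) :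
    (qBall n Q Δ).card ≤ 2 * (pointSet n Q Δ hΔ).card := by
  rw [card_pointSet]; exact card_qBall_le_two_mul n Q Δ

/-! ### The shift estimate (Cor. 3.9 / Claim 3.14 for the point set) -/

section Shift

variable {m : ℕ}

/-- A coordinate is at most the Euclidean norm. [folklore] -/
theorem abs_apply_le_norm (x : EuclideanSpace ℝ (Fin (m + 1))) (i : Fin (m + 1)) : |x i| ≤ ‖x‖ := by
  have h := norm_sq_eq_sum (m + 1) x
  have hi : (x i) ^ 2 ≤ ∑ j, (x j) ^ 2 := Finset.single_le_sum (fun j _ => sq_nonneg (x j)) (Finset.mem_univ i)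
  rw [← h] at hi
  exact abs_le_of_sq_le_sq' hi (norm_nonneg _) |>.2 |> fun h2 => abs_le.2 ⟨(abs_le_of_sq_le_sq' hi (norm_nonneg _)).1, h2⟩

/-- **Where the points with a lost partner lie.** For the point set `X = pointSet (m+1) Q Δ` and a
shift `s ∈ ℤ^{m+1}`, every `x ∈ X` with `x − s ∉ X` lies in `U₁ ∪ U₂`: `U₁` the points of the
quantised ball whose translate by `−s` is farther than `R₋ = √((Q − (m+1))Δ)` from the origin
(it left the inner ball, hence the quantised ball), `U₂` the points of the quantised ball in the
slab `c − |s₀| ≤ x₀ ≤ c` below the threshold `c` of the lexicographic prefix (it crossed the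
cut). [cite: Regev2004, Claim 3.14 (proof, second paragraph, p. 15)] -/
theorem filter_sub_notMem_subset {Q Δ : ℕ} (hΔ : 0 < Δ) (hQ : m + 1 ≤ Q) (s : Fin (m + 1) → ℤ) :
    ∃ c : ℤ, ((pointSet (m + 1) Q Δ hΔ).filter fun x => x - s ∉ pointSet (m + 1) Q Δ hΔ) ⊆
      ((qBall (m + 1) Q Δ).filter fun x =>
          Real.sqrt (((Q : ℝ) - (m + 1)) * Δ) < ‖intVecToEuclidean (m + 1) (x - s)‖) ∪
        ((qBall (m + 1) Q Δ).filter fun x => c - |s 0| ≤ x 0 ∧ x 0 ≤ c) := by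
  obtain ⟨c, hlow, hhigh⟩ := lexPrefix_threshold (qBall (m + 1) Q Δ) (two_pow_kappa_le (m + 1) Q Δ hΔ)
  refine ⟨c, fun x hx => ?_⟩
  rw [Finset.mem_filter] at hx
  obtain ⟨hxX, hxs⟩ := hx
  have hxS : x ∈ qBall (m + 1) Q Δ := pointSet_subset_qBall _ _ _ hΔ hxX
  rw [Finset.mem_union, Finset.mem_filter, Finset.mem_filter]
  by_cases hS : x - s ∈ qBall (m + 1) Q Δ
  · -- the translate is in the quantised ball but beyond the cut
    right
    refine ⟨hxS, ?_, hhigh x hxX⟩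
    have hnot : ¬ (x - s) 0 < c := fun hlt => hxs (hlow _ hS hlt)
    simp only [Pi.sub_apply, not_lt] at hnot
    have := neg_abs_le (s 0)
    linarith
  · -- the translate left the quantised ball, hence the inner ball
    left
    refine ⟨hxS, ?_⟩
    by_contra hle
    push Not at hle
    apply hS
    refine mem_qBall_of_norm_sq_le hΔ hQ ?_
    have h0 : 0 ≤ ((Q : ℝ) - (m + 1)) * Δ := by
      have : ((m : ℝ) + 1) ≤ Q := by exact_mod_cast hQ
      have : (0 : ℝ) ≤ Δ := by positivity
      nlinarith
    calc ‖intVecToEuclidean (m + 1) (x - s)‖ ^ 2 ≤ (Real.sqrt (((Q : ℝ) - (m + 1)) * Δ)) ^ 2 :=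
          pow_le_pow_left₀ (norm_nonneg _) hle 2
      _ = ((Q : ℝ) - ↑(m + 1)) * Δ := by rw [Real.sq_sqrt h0]; push_cast; ring

/-- The quantised ball lies in the closed ball of radius `R₊ = √(QΔ)`. [folklore] -/
theorem norm_le_of_mem_qBall {Q Δ : ℕ} (hΔ : 0 < Δ) {x : Fin (m + 1) → ℤ} (hx : x ∈ qBall (m + 1) Q Δ) :
    ‖intVecToEuclidean (m + 1) x‖ ≤ Real.sqrt ((Q : ℝ) * Δ) := by
  rw [← Real.sqrt_sq (norm_nonneg _)]
  exact Real.sqrt_le_sqrt (norm_sq_le_of_mem_qBall hΔ hx)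

/-- **`U₁` is small: it lies in the `√n`-thickening of an annulus-like region**, whose volume is at
most `[V(R′) − V(r′)] + ‖s‖ · V_{m}(r′)` with `R′ = √(QΔ) + √(m+1) + 1`, `r′ = √((Q−(m+1))Δ) − √(m+1)`
(count-to-volume by the unit cells, then the shell and Claim 3.7).
[cite: Regev2004, Cor. 3.9 (proof) and Claim 3.7] -/
theorem card_U1_le {Q Δ : ℕ} (hΔ : 0 < Δ) (s : Fin (m + 1) → ℤ) :
    (((qBall (m + 1) Q Δ).filter fun x =>
        Real.sqrt (((Q : ℝ) - (m + 1)) * Δ) < ‖intVecToEuclidean (m + 1) (x - s)‖).card : ENNReal) ≤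
      (volume (ball (0 : EuclideanSpace ℝ (Fin (m + 1))) (Real.sqrt ((Q : ℝ) * Δ) + Real.sqrt (m + 1 : ℝ) + 1)) -
          volume (ball (0 : EuclideanSpace ℝ (Fin (m + 1))) (Real.sqrt (((Q : ℝ) - (m + 1)) * Δ) - Real.sqrt (m + 1 : ℝ)))) +
        ENNReal.ofReal ‖intVecToEuclidean (m + 1) s‖ *
          volume (ball (0 : EuclideanSpace ℝ (Fin m)) (Real.sqrt (((Q : ℝ) - (m + 1)) * Δ) - Real.sqrt (m + 1 : ℝ))) := by
  set Rp : ℝ := Real.sqrt ((Q : ℝ) * Δ) with hRp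
  set Rm : ℝ := Real.sqrt (((Q : ℝ) - (m + 1)) * Δ) with hRm
  set ρ : ℝ := Real.sqrt (m + 1 : ℝ) with hρ
  set sv : EuclideanSpace ℝ (Fin (m + 1)) := intVecToEuclidean (m + 1) s with hsv
  set A : Set (EuclideanSpace ℝ (Fin (m + 1))) := {a | ‖a‖ ≤ Rp ∧ Rm < ‖a - sv‖} with hA
  -- count to volume
  have h1 := card_le_volume_thickening A
    ((qBall (m + 1) Q Δ).filter fun x => Rm < ‖intVecToEuclidean (m + 1) (x - s)‖) (fun z hz => by
      rw [Finset.mem_filter] at hz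
      exact ⟨norm_le_of_mem_qBall hΔ hz.1, by rw [hsv, ← map_sub]; exact hz.2⟩)
  have hρn : Real.sqrt ((m + 1 : ℕ) : ℝ) = ρ := by rw [hρ]; push_cast; rfl
  rw [hρn] at h1
  -- the thickening lies in `ball(0, R′) ∖ closedBall(s, r′)`
  have hsub : {x : EuclideanSpace ℝ (Fin (m + 1)) | ∃ a ∈ A, ‖x - a‖ ≤ ρ} ⊆
      ball (0 : EuclideanSpace ℝ (Fin (m + 1))) (Rp + ρ + 1) \ closedBall sv (Rm - ρ) := by
    rintro x ⟨a, ⟨ha1, ha2⟩, hxa⟩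
    constructor
    · rw [mem_ball_zero_iff]
      calc ‖x‖ = ‖(x - a) + a‖ := by rw [sub_add_cancel]
        _ ≤ ‖x - a‖ + ‖a‖ := norm_add_le _ _
        _ < Rp + ρ + 1 := by linarith
    · rw [mem_closedBall, dist_eq_norm, not_le]
      have : ‖a - sv‖ ≤ ‖a - x‖ + ‖x - sv‖ := by
        calc ‖a - sv‖ = ‖(a - x) + (x - sv)‖ := by rw [sub_add_sub_cancel]
          _ ≤ ‖a - x‖ + ‖x - sv‖ := norm_add_le _ _
      rw [norm_sub_rev a x] at this
      linarith
  -- split the difference set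
  have hsplit : ball (0 : EuclideanSpace ℝ (Fin (m + 1))) (Rp + ρ + 1) \ closedBall sv (Rm - ρ) ⊆
      (ball (0 : EuclideanSpace ℝ (Fin (m + 1))) (Rp + ρ + 1) \ ball 0 (Rm - ρ)) ∪ (ball 0 (Rm - ρ) \ ball sv (Rm - ρ)) := by
    intro x hx
    by_cases hxm : x ∈ ball (0 : EuclideanSpace ℝ (Fin (m + 1))) (Rm - ρ)
    · exact Or.inr ⟨hxm, fun h => hx.2 (ball_subset_closedBall h)⟩
    · exact Or.inl ⟨hx.1, hxm⟩
  have hle : Rm - ρ ≤ Rp + ρ + 1 := by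
    have : Rm ≤ Rp := by
      rw [hRm, hRp]
      apply Real.sqrt_le_sqrt
      have : (0 : ℝ) ≤ Δ := by positivity
      nlinarith
    have : 0 ≤ ρ := Real.sqrt_nonneg _
    linarith
  calc (((qBall (m + 1) Q Δ).filter fun x => Rm < ‖intVecToEuclidean (m + 1) (x - s)‖).card : ENNReal)
      ≤ volume {x : EuclideanSpace ℝ (Fin (m + 1)) | ∃ a ∈ A, ‖x - a‖ ≤ ρ} := h1
    _ ≤ volume ((ball (0 : EuclideanSpace ℝ (Fin (m + 1))) (Rp + ρ + 1) \ ball 0 (Rm - ρ)) ∪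
          (ball 0 (Rm - ρ) \ ball sv (Rm - ρ))) := measure_mono (hsub.trans hsplit)
    _ ≤ volume (ball (0 : EuclideanSpace ℝ (Fin (m + 1))) (Rp + ρ + 1) \ ball 0 (Rm - ρ)) +
          volume (ball (0 : EuclideanSpace ℝ (Fin (m + 1))) (Rm - ρ) \ ball sv (Rm - ρ)) := measure_union_le _ _
    _ ≤ _ := by
        gcongr
        · rw [measure_sdiff (ball_subset_ball hle) measurableSet_ball.nullMeasurableSet measure_ball_lt_top.ne]
        · exact volume_ball_diff_ball_le m (Rm - ρ) sv

/-- **`U₂` is small: a slab of width `|s₀|`**, at most `(‖s‖ + 2√(m+1)) · V_m(R′)` points.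
[cite: Regev2004, Claim 3.7 (proof: the slab/cylinder bound)] -/
theorem card_U2_le {Q Δ : ℕ} (hΔ : 0 < Δ) (s : Fin (m + 1) → ℤ) (c : ℤ) :
    (((qBall (m + 1) Q Δ).filter fun x => c - |s 0| ≤ x 0 ∧ x 0 ≤ c).card : ENNReal) ≤
      ENNReal.ofReal (‖intVecToEuclidean (m + 1) s‖ + 2 * Real.sqrt (m + 1 : ℝ)) *
        volume (ball (0 : EuclideanSpace ℝ (Fin m)) (Real.sqrt ((Q : ℝ) * Δ) + Real.sqrt (m + 1 : ℝ) + 1)) := by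
  set Rp : ℝ := Real.sqrt ((Q : ℝ) * Δ) with hRp
  set ρ : ℝ := Real.sqrt (m + 1 : ℝ) with hρ
  set A : Set (EuclideanSpace ℝ (Fin (m + 1))) := {a | ‖a‖ ≤ Rp ∧ (c : ℝ) - |(s 0 : ℝ)| ≤ a 0 ∧ a 0 ≤ c} with hA
  have h1 := card_le_volume_thickening A
    ((qBall (m + 1) Q Δ).filter fun x => c - |s 0| ≤ x 0 ∧ x 0 ≤ c) (fun z hz => by
      rw [Finset.mem_filter] at hz
      refine ⟨norm_le_of_mem_qBall hΔ hz.1, ?_, ?_⟩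
      · have : ((c - |s 0| : ℤ) : ℝ) ≤ (z 0 : ℝ) := by exact_mod_cast hz.2.1
        simpa [intVecToEuclidean_apply] using this
      · have : (z 0 : ℝ) ≤ c := by exact_mod_cast hz.2.2
        simpa [intVecToEuclidean_apply] using this)
  have hρn : Real.sqrt ((m + 1 : ℕ) : ℝ) = ρ := by rw [hρ]; push_cast; rfl
  rw [hρn] at h1
  have hs0 : |(s 0 : ℝ)| ≤ ‖intVecToEuclidean (m + 1) s‖ := by
    have := abs_apply_le_norm (intVecToEuclidean (m + 1) s) 0
    simpa [intVecToEuclidean_apply] using this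
  -- the thickening lies in a slab of the ball of radius `R′`
  have hsub : {x : EuclideanSpace ℝ (Fin (m + 1)) | ∃ a ∈ A, ‖x - a‖ ≤ ρ} ⊆
      {x | x ∈ ball (0 : EuclideanSpace ℝ (Fin (m + 1))) (Rp + ρ + 1) ∧
        ((c : ℝ) - |(s 0 : ℝ)| - ρ) ≤ x 0 ∧ x 0 ≤ c + ρ} := by
    rintro x ⟨a, ⟨ha1, ha2, ha3⟩, hxa⟩
    have h0 : |(x - a) 0| ≤ ρ := (abs_apply_le_norm (x - a) 0).trans hxa
    rw [PiLp.sub_apply, abs_le] at h0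
    refine ⟨?_, by linarith, by linarith⟩
    rw [mem_ball_zero_iff]
    calc ‖x‖ = ‖(x - a) + a‖ := by rw [sub_add_cancel]
      _ ≤ ‖x - a‖ + ‖a‖ := norm_add_le _ _
      _ < Rp + ρ + 1 := by linarith
  calc (((qBall (m + 1) Q Δ).filter fun x => c - |s 0| ≤ x 0 ∧ x 0 ≤ c).card : ENNReal)
      ≤ volume {x : EuclideanSpace ℝ (Fin (m + 1)) | ∃ a ∈ A, ‖x - a‖ ≤ ρ} := h1
    _ ≤ volume {x | x ∈ ball (0 : EuclideanSpace ℝ (Fin (m + 1))) (Rp + ρ + 1) ∧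
        ((c : ℝ) - |(s 0 : ℝ)| - ρ) ≤ x 0 ∧ x 0 ≤ c + ρ} := measure_mono hsub
    _ ≤ ENNReal.ofReal ((c + ρ) - ((c : ℝ) - |(s 0 : ℝ)| - ρ)) * volume (ball (0 : EuclideanSpace ℝ (Fin m)) (Rp + ρ + 1)) :=
        volume_ball_inter_slab_le m _ _ _
    _ ≤ _ := by
        gcongr
        linarith

/-- **The lower count: `V(r′) ≤ |qBall| ≤ 2 |pointSet|`** — the inner ball's `√n`-erosion contains
`B(0, r′)`, all of whose integer points lie in the quantised ball.
[cite: Regev2004, Cor. 3.9 (proof: the bodies contain the ball of radius R/2)] -/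
theorem volume_ball_le_two_mul_card_pointSet {Q Δ : ℕ} (hΔ : 0 < Δ) (hQ : m + 1 ≤ Q) :
    volume (ball (0 : EuclideanSpace ℝ (Fin (m + 1))) (Real.sqrt (((Q : ℝ) - (m + 1)) * Δ) - Real.sqrt (m + 1 : ℝ))) ≤
      2 * ((pointSet (m + 1) Q Δ hΔ).card : ENNReal) := by
  set Rm : ℝ := Real.sqrt (((Q : ℝ) - (m + 1)) * Δ) with hRm
  set ρ : ℝ := Real.sqrt (m + 1 : ℝ) with hρ
  set A : Set (EuclideanSpace ℝ (Fin (m + 1))) := closedBall 0 Rm with hA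
  have h0 : 0 ≤ ((Q : ℝ) - (m + 1)) * Δ := by
    have : ((m : ℝ) + 1) ≤ Q := by exact_mod_cast hQ
    have : (0 : ℝ) ≤ Δ := by positivity
    nlinarith
  have h1 := volume_erosion_le_card A (qBall (m + 1) Q Δ) (fun z hz => by
    rw [hA, mem_closedBall, dist_zero_right] at hz
    refine mem_qBall_of_norm_sq_le hΔ hQ ?_
    calc ‖intVecToEuclidean (m + 1) z‖ ^ 2 ≤ Rm ^ 2 := pow_le_pow_left₀ (norm_nonneg _) hz 2
      _ = ((Q : ℝ) - ↑(m + 1)) * Δ := by rw [hRm, Real.sq_sqrt h0]; push_cast; ring)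
  have hρn : Real.sqrt ((m + 1 : ℕ) : ℝ) = ρ := by rw [hρ]; push_cast; rfl
  rw [hρn] at h1
  have hsub : ball (0 : EuclideanSpace ℝ (Fin (m + 1))) (Rm - ρ) ⊆ {x | closedBall x ρ ⊆ A} := by
    intro x hx y hy
    rw [mem_ball_zero_iff] at hx
    rw [mem_closedBall, dist_eq_norm] at hy
    rw [hA, mem_closedBall, dist_zero_right]
    calc ‖y‖ = ‖(y - x) + x‖ := by rw [sub_add_cancel]
      _ ≤ ‖y - x‖ + ‖x‖ := norm_add_le _ _
      _ ≤ Rm := by linarith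
  calc volume (ball (0 : EuclideanSpace ℝ (Fin (m + 1))) (Rm - ρ)) ≤ volume {x | closedBall x ρ ⊆ A} := measure_mono hsub
    _ ≤ ((qBall (m + 1) Q Δ).card : ENNReal) := h1
    _ ≤ 2 * ((pointSet (m + 1) Q Δ hΔ).card : ENNReal) := by
        exact_mod_cast card_qBall_le_two_mul_card_pointSet (m + 1) Q Δ hΔ

/-- **The shift estimate for the point set** (Cor. 3.9 / Claim 3.14, second error term, before
division): for every shift `s ∈ ℤ^{m+1}`,
`#{x ∈ X | x − s ∉ X} ≤ [V(R′) − V(r′)] + ‖s‖ V_m(r′) + (‖s‖ + 2√(m+1)) V_m(R′)`.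
Dividing by `|X| ≥ V(r′)/2` and inserting the section ratio `V_m(ρ) ≤ (e^{1/2}√(m+1)/(2ρ)) V(ρ)`
and the scaling `V(R′) = (R′/r′)^{m+1} V(r′)` gives Regev's `O(√n ‖s‖ / R)` plus the shell term.
[cite: Regev2004, Cor. 3.9 and Claim 3.14 (p. 15)] -/
theorem card_filter_sub_notMem_le_volume {Q Δ : ℕ} (hΔ : 0 < Δ) (hQ : m + 1 ≤ Q) (s : Fin (m + 1) → ℤ) :
    (((pointSet (m + 1) Q Δ hΔ).filter fun x => x - s ∉ pointSet (m + 1) Q Δ hΔ).card : ENNReal) ≤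
      (volume (ball (0 : EuclideanSpace ℝ (Fin (m + 1))) (Real.sqrt ((Q : ℝ) * Δ) + Real.sqrt (m + 1 : ℝ) + 1)) -
          volume (ball (0 : EuclideanSpace ℝ (Fin (m + 1))) (Real.sqrt (((Q : ℝ) - (m + 1)) * Δ) - Real.sqrt (m + 1 : ℝ)))) +
        ENNReal.ofReal ‖intVecToEuclidean (m + 1) s‖ *
          volume (ball (0 : EuclideanSpace ℝ (Fin m)) (Real.sqrt (((Q : ℝ) - (m + 1)) * Δ) - Real.sqrt (m + 1 : ℝ))) +
        ENNReal.ofReal (‖intVecToEuclidean (m + 1) s‖ + 2 * Real.sqrt (m + 1 : ℝ)) *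
          volume (ball (0 : EuclideanSpace ℝ (Fin m)) (Real.sqrt ((Q : ℝ) * Δ) + Real.sqrt (m + 1 : ℝ) + 1)) := by
  classical
  obtain ⟨c, hc⟩ := filter_sub_notMem_subset hΔ hQ s
  calc (((pointSet (m + 1) Q Δ hΔ).filter fun x => x - s ∉ pointSet (m + 1) Q Δ hΔ).card : ENNReal)
      ≤ ((((qBall (m + 1) Q Δ).filter fun x =>
            Real.sqrt (((Q : ℝ) - (m + 1)) * Δ) < ‖intVecToEuclidean (m + 1) (x - s)‖) ∪
          ((qBall (m + 1) Q Δ).filter fun x => c - |s 0| ≤ x 0 ∧ x 0 ≤ c)).card : ENNReal) := by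
        exact_mod_cast Finset.card_le_card hc
    _ ≤ (((qBall (m + 1) Q Δ).filter fun x =>
            Real.sqrt (((Q : ℝ) - (m + 1)) * Δ) < ‖intVecToEuclidean (m + 1) (x - s)‖).card : ENNReal) +
          (((qBall (m + 1) Q Δ).filter fun x => c - |s 0| ≤ x 0 ∧ x 0 ≤ c).card : ENNReal) := by
        exact_mod_cast Finset.card_union_le _ _
    _ ≤ _ := add_le_add (card_U1_le hΔ s) (card_U2_le hΔ s c)

end Shift

end Regev2004

end Literature.Algebra.EuclideanLattices

end
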